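import Summits.BirchSwinnertonDyer.BirchSwinnertonDyer.Theorems.AdditiveKolyvaginRoadBottomRankOneAdditiveClassOfPoint
import Summits.BirchSwinnertonDyer.BirchSwinnertonDyer.Theses.AdditiveKolyvaginRoad
import Literature.NumberTheory.EllipticCurves.BSDRankZeroDensityProofs
import Literature.NumberTheory.EllipticCurves.BSDSelmerPConverseYanZhuShaFiniteCoreProofs
import Literature.NumberTheory.EllipticCurves.BSDSelmerCMPConverseHeegnerFieldProofs
import Literature.NumberTheory.EllipticCurves.NonEisensteinPrimeOfSurjective
import HarnessLib

/-!
# Route `AdditiveKolyvaginRoad`, crux `BottomRankOneAdditive` (item stmt-BirchSwinnertonDyer-21397):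
# the crux CONTAINS the non-torsion of the Heegner point on its frames — a torsion `y_K` is `p`-divisible in
# `E(K[1])`, so `c(1) ≠ 0` forces `y_K` to have infinite order (Gross–Zagier's conclusion), with NO published input
# (cell `pub/bsd-wall`, lead prover `bsd-wall-akr-p3` g0; `--supports stmt-BirchSwinnertonDyer-21397 --as helper`)

THEOREMS ONLY (no definition, no named fact, no `sorry`); nothing about Kolyvagin's conjecture or about Gross–Zagier is
asserted; BSD is not proved by any of this.

WHY THIS FILE. The crux `Theses.AdditiveKolyvaginRoad.BottomRankOneAdditive` is typed WITHOUT the route's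
published-inputs binder `PublishedInputsAdditiveKoly` (which the kernel `AdditiveKolyvaginKernel` and the composition
`KolyvaginPrimitiveOfLevelSystemsAdditive` do carry). This file records, kernel-checked, what that costs a prover:

* §1 `pDiv_of_isOfFinAddOrder_derivedPoint` — for `p` odd with `ρ̄_{E,p}` onto and `K` imaginary quadratic, a TORSION
  derived point `P(n) ∈ E(K[n])` (`n ≠ 0`) is `p^M`-divisible in `E(K[n])` for every `M` (`E(K[n])[p] = 0` by Gross's
  Lemma 4.3, `RingClassNoTorsion.eq_zero_of_zsmul_pow_eq_zero_ringClassField`, so `p ∤ ord P(n)` and `[p^M]` is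
  invertible on `⟨P(n)⟩`); hence (`Koly.not_pDiv_of_kolyvaginClass_ne_zero`, McCallum Cor. 4.5 «if»)
  `not_isOfFinAddOrder_derivedPoint_of_kolyvaginClass_ne_zero` — **a non-zero `c_M(n)` forces `P(n)` to have
  infinite order** (the contrapositive of Gross 1991, Prop. 4.7 (1) for torsion points; W. Zhang 2014, proof of
  Thm. 1.3, p. 196).
* §2 `bottomRankOneAdditive_forces_heegnerPoint_infinite_order` — CLASS LEVEL: `BottomRankOneAdditive` implies that at
  every ♯ additive frame with `#Sel_p(E/K) = p` the conductor-`1` Heegner point `y_K ∈ E(K)` (a Heegner point of level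
  `N_E` in the sense of `IsHeegnerPoint`, over `P(1)`) has INFINITE ORDER — i.e. the crux contains, on its frames, the
  non-torsion conclusion of the Gross–Zagier theorem (tree named fact `gross_zagier`, NOT proved in the tree; on these
  frames `L'(E/K,1) ≠ 0` since `r_an(E) = 1` and `L(E^{(d_K)},1) ≠ 0`). CONSEQUENCE for the plan (lead's census): as
  typed, the crux cannot be closed in the tree without formalising Gross–Zagier's non-torsion theorem (or a
  `p`-converse of equal strength), independently of the additive-`p` anchor; the variant carrying the binder
  `PublishedInputsAdditiveKoly →` in front is consumed identically by item 21266's composition and isolates the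
  additive-`p` content (see `…BottomRankOneAdditiveTight`: modulo the published inputs the crux is implied by
  `BSD_p(E) ∧ BSD_p(E^{(d_K)})`).

References (locators only): [cite: GrossLMS1991, Lemma 4.3, Prop. 4.7 (1), §4 (P_1 = y_K)] [cite: WZhang2014, proof of
Thm. 1.3 (p. 196)] [cite: McCallumLMS1991, Cor. 4.5] [cite: GrossZagier1986, I.(6.5), V.§2].
-/

-- single-conjunct summit: `Summit.BirchSwinnertonDyer.BirchSwinnertonDyer.…` repeats the name by design
set_option linter.dupNamespace false

set_option autoImplicit false

noncomputable section

open scoped Classical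

namespace Summit.BirchSwinnertonDyer.BirchSwinnertonDyer.Theorems.AdditiveKoly

open WeierstrassCurve NumberField Field
  Literature.NumberTheory.EllipticCurves Literature.NumberTheory.EllipticCurves.ModularForms
  Literature.NumberTheory.EllipticCurves.Rank1Residual
  Summit.BirchSwinnertonDyer.Rank1Residual Summit.BirchSwinnertonDyer.Rank1Residual.X11b
  Summit.BirchSwinnertonDyer.Rank1Residual.X11b.Three
  Summit.BirchSwinnertonDyer.BirchSwinnertonDyer.Theses.AdditiveKolyvaginRoad

/-! ## §1 A torsion derived point is `p`-divisible; a non-zero class forces infinite order -/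

section Torsion

variable {K : Type} [Field K] [NumberField K] {N : ℕ} [NeZero N] (W : WeierstrassCurve ℚ) [W.IsElliptic]
  {Dt : ModularParametrizationData W N} {β : ℤ} (ι : K →+* ℂ) {n : ℕ}

/-- **A torsion `P(n)` is `p^M`-divisible in `E(K[n])`** (`p` odd, `ρ̄_{E,p}` onto, `K` imaginary quadratic, `n ≠ 0`):
`E(K[n])` has no `p`-torsion (Gross 1991, Lemma 4.3: `eq_zero_of_zsmul_pow_eq_zero_ringClassField`), so the order of
`P(n)` is prime to `p` and `[p^M]` is invertible on the cyclic group `⟨P(n)⟩` (`exists_nsmul_eq_self_of_coprime`).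
The «torsion ⇒ `c_M(n) = 0`» step of Gross 1991 Prop. 4.7 (1) ∕ W. Zhang 2014 proof of Thm. 1.3, in the point
currency `Koly.PDiv`. [cite: GrossLMS1991, Lemma 4.3 and Prop. 4.7 (1)] [cite: WZhang2014, proof of Thm. 1.3 (p. 196)] -/
theorem pDiv_of_isOfFinAddOrder_derivedPoint (hK : IsImaginaryQuadratic K) (hn : n ≠ 0) {p : ℕ} (hp : p.Prime)
    (hp2 : p ≠ 2) (hs : W.HasSurjectiveModNGaloisRep p) (d : KolyvaginHeegnerData Dt β ι n)
    (hfin : IsOfFinAddOrder d.derivedPoint) (M : ℕ) : Koly.PDiv d p M := by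
  -- `p ∤ ord P(n)`: otherwise `(ord P(n) / p) • P(n)` is a non-zero `p`-torsion point of `E(K[n])`
  have hord : 0 < addOrderOf d.derivedPoint := addOrderOf_pos_iff.mpr hfin
  have hcop : (p ^ M).Coprime (addOrderOf d.derivedPoint) := by
    apply Nat.Coprime.pow_left
    rw [Nat.Prime.coprime_iff_not_dvd hp]
    rintro ⟨k, hk⟩
    have hk0 : 0 < k := Nat.pos_of_ne_zero fun h ↦ by rw [h, mul_zero] at hk; omega
    have hR : ((p ^ 1 : ℕ) : ℤ) • (k • d.derivedPoint) = 0 := by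
      rw [natCast_zsmul, pow_one, smul_smul, ← hk]
      exact addOrderOf_nsmul_eq_zero d.derivedPoint
    have hR0 : k • d.derivedPoint = 0 :=
      RingClassNoTorsion.eq_zero_of_zsmul_pow_eq_zero_ringClassField W hK ι hn hp hp2 hs 1 _ hR
    have hdvd : addOrderOf d.derivedPoint ∣ k := addOrderOf_dvd_of_nsmul_eq_zero hR0
    have hle : addOrderOf d.derivedPoint ≤ k := Nat.le_of_dvd hk0 hdvd
    have hp1 : 2 ≤ p := hp.two_le
    nlinarith
  -- `[p^M]` is invertible on `⟨P(n)⟩`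
  obtain ⟨m, hm⟩ := exists_nsmul_eq_self_of_coprime hcop
  refine ⟨m • d.derivedPoint, ?_⟩
  rw [natCast_zsmul, smul_comm, hm]

/-- **A non-zero `c_M(n)` forces `P(n)` to have infinite order** (`p` odd, `ρ̄_{E,p}` onto, `K` imaginary quadratic,
`n ≠ 0`): a non-zero class is a point certificate `p^M ∤ P(n)` (McCallum Cor. 4.5 «if»,
`Koly.not_pDiv_of_kolyvaginClass_ne_zero`), and a torsion `P(n)` would be `p^M`-divisible
(`pDiv_of_isOfFinAddOrder_derivedPoint`). [cite: GrossLMS1991, Prop. 4.7 (1)] [cite: McCallumLMS1991, Cor. 4.5] -/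
theorem not_isOfFinAddOrder_derivedPoint_of_kolyvaginClass_ne_zero (hK : IsImaginaryQuadratic K) (hn : n ≠ 0)
    {p : ℕ} (hp : p.Prime) (hp2 : p ≠ 2) (hs : W.HasSurjectiveModNGaloisRep p)
    (d : KolyvaginHeegnerData Dt β ι n) {M : ℕ} (hne : d.kolyvaginClass hp M ≠ 0) :
    ¬ IsOfFinAddOrder d.derivedPoint := fun hfin ↦
  Koly.not_pDiv_of_kolyvaginClass_ne_zero d hne (pDiv_of_isOfFinAddOrder_derivedPoint W ι hK hn hp hp2 hs d hfin M)

end Torsion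

/-! ## §2 Class level: the crux contains the non-torsion of `y_K` on its frames -/

/-- **`BottomRankOneAdditive` forces the Heegner point to have infinite order on every one of its frames.** Granted the
crux, at every ♯ additive frame `(W, p ≥ 5, K, Dt, β, ι)` (`Addv W p`, `ρ̄_{E,p}` onto, ♠(1), ♠(2), `p ∤ ∏ c_ℓ`,
`r_an = 1`, `K` imaginary quadratic, `d_K` odd, `d_K < −4`, Heegner hypothesis, `L(E^{(d_K)},1) ≠ 0`, `4N ∣ β² − d_K`,
`p ∤ c(Dt)`) with `#Sel_p(E/K) = p`, there is a point `y_K ∈ E(K)` which is a Heegner point of level `N_E`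
(`IsHeegnerPoint`), maps to the conductor-`1` derived point `P(1)` of the crux's datum, and has INFINITE ORDER
(§1 at `n = 1` + the descent `exists_isHeegnerPoint_map_eq_derivedPoint_one`, Shimura reciprocity at conductor `1`
PROVED). This is, on these frames, the conclusion of Gross–Zagier's theorem (`L'(E/K,1) ≠ 0 ⇒ ĥ(y_K) ≠ 0`; the
tree's named fact `gross_zagier`, not proved in the tree) — obtained here from the crux ALONE: a prover of the crux
as typed must re-derive it without `PublishedInputsAdditiveKoly`. CONDITIONAL on the crux; nothing is booked.
[cite: GrossLMS1991, §1 (1.1) and §4 (P_1 = y_K)] [cite: GrossZagier1986, I.(6.5)] -/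
theorem bottomRankOneAdditive_forces_heegnerPoint_infinite_order (hBOT : BottomRankOneAdditive) :
    ∀ (W : WeierstrassCurve ℚ) [W.IsElliptic] [W.IsGloballyMinimal] [NeZero (W.conductorNorm ℤ)]
      (p : ℕ) [Fact p.Prime] (K : Type) [Field K] [NumberField K]
      (Dt : ModularParametrizationData W (W.conductorNorm ℤ)) (β : ℤ) (ι : K →+* ℂ),
      5 ≤ p → Addv W p → W.HasSurjectiveModNGaloisRep p →
      (∀ (ℓ : ℕ) [Fact ℓ.Prime], W.HasMultiplicativeReductionAtPrime ℓ →
        ¬ p ∣ padicValInt ℓ W.minimalDiscriminantInt) →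
      (∃ (ℓ₁ ℓ₂ : ℕ) (_ : Fact ℓ₁.Prime) (_ : Fact ℓ₂.Prime), ℓ₁ ≠ ℓ₂ ∧
        W.HasMultiplicativeReductionAtPrime ℓ₁ ∧ W.HasMultiplicativeReductionAtPrime ℓ₂) →
      ¬ p ∣ W.tamagawaProduct → W.analyticRank = 1 →
      IsImaginaryQuadratic K → Odd (NumberField.discr K) → NumberField.discr K < -4 →
      SatisfiesHeegnerHypothesis (W.conductorNorm ℤ) K →
      (W.quadraticTwist (NumberField.discr K : ℚ)).entireLFunction 1 ≠ 0 →
      (4 * (W.conductorNorm ℤ : ℤ)) ∣ β ^ 2 - NumberField.discr K → ¬ (p : ℤ) ∣ Dt.c →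
      Nat.card (WeierstrassCurve.selmerGroup (W.baseChange K) (p : ℤ)) = p →
      ∃ (d : KolyvaginHeegnerData Dt β ι 1) (yK : (W.baseChange K).toAffine.Point),
        IsHeegnerPoint (W.conductorNorm ℤ) W K yK ∧
        WeierstrassCurve.Affine.Point.map (W' := W) (algebraMap K (ringClassField K ι 1)).toRatAlgHom yK =
          d.derivedPoint ∧
        ¬ IsOfFinAddOrder yK := by
  intro W _ _ _ p hp K _ _ Dt β ι hp5 hadd hs hsp htwo htam hr hK hodd hlt hH hL hβ hc hSel
  obtain ⟨d, hne⟩ := hBOT W p K Dt β ι hp5 hadd hs hsp htwo htam hr hK hodd hlt hH hL hβ hc hSel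
  obtain ⟨yK, hyK, hmap⟩ := exists_isHeegnerPoint_map_eq_derivedPoint_one W K Dt β ι hK hH d
  refine ⟨d, yK, hyK, hmap, fun hfin ↦ ?_⟩
  refine not_isOfFinAddOrder_derivedPoint_of_kolyvaginClass_ne_zero W ι hK one_ne_zero hp.out (by omega) hs d hne ?_
  rw [← hmap]
  exact AddMonoidHom.isOfFinAddOrder
    (WeierstrassCurve.Affine.Point.map (W' := W) (algebraMap K (ringClassField K ι 1)).toRatAlgHom) hfin

end Summit.BirchSwinnertonDyer.BirchSwinnertonDyer.Theorems.AdditiveKoly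

end


/-! ## §3 (appended, lead akr-p3 g0) The open stubs' point statement also contains «rank `E(K) = 1` and `Ш(E/K)[p] = 0`»

On a ♯ frame with `#Sel_p(E/K) = p` and `E[p]` irreducible, a point `y_K ∈ E(K)` outside `pE(K)` is non-torsion
(`E(K)[p] = 0`), so `rank E(K) ≥ 1`, and the EXACT DESCENT COUNT `#Sel^(p)(E/K) = p^{rank} · #E(K)[p] · #Ш(E/K)[p]`
(Silverman AEC X.4.2, tree theorem `WeierstrassCurve.natCard_selmerGroup_eq`) leaves `rank E(K) = 1` and
`Ш(E/K)[p] = 0` — Kolyvagin's rank-one conclusions mod `p`, obtained from the point statement ALONE (no published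
input). Class level: `BottomRankOneAdditive` forces them on every one of its frames.
-/

noncomputable section

open scoped Classical

namespace Summit.BirchSwinnertonDyer.BirchSwinnertonDyer.Theorems.AdditiveKoly

open WeierstrassCurve NumberField Field
  Literature.NumberTheory.EllipticCurves Literature.NumberTheory.EllipticCurves.ModularForms
  Literature.NumberTheory.EllipticCurves.Rank1Residual
  Summit.BirchSwinnertonDyer.Rank1Residual Summit.BirchSwinnertonDyer.Rank1Residual.X11b
  Summit.BirchSwinnertonDyer.Rank1Residual.X11b.Three
  Summit.BirchSwinnertonDyer.BirchSwinnertonDyer.Theses.AdditiveKolyvaginRoad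

section Rank

variable {K : Type} [Field K] [NumberField K] (W : WeierstrassCurve ℚ) [W.IsElliptic]

/-- **A point of `E(K)` outside `pE(K)` has infinite order when `E[p]` is irreducible** (`K` imaginary quadratic,
`p` prime): `E(K)[p] = 0` (`torsionBy_eq_bot_of_isImaginaryQuadratic_of_hasIrreducibleModPGaloisRep`), so the order of
a torsion point is prime to `p` and `[p]` is invertible on the cyclic group it generates
(`exists_nsmul_eq_self_of_coprime`). [cite: GrossLMS1991, Lemma 4.3] [cite: SilvermanAEC2009, Thm X.4.2] -/
theorem not_isOfFinAddOrder_of_not_exists_zsmul_eq (hK : IsImaginaryQuadratic K) {p : ℕ} (hp : p.Prime)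
    (hirr : W.HasIrreducibleModPGaloisRep p) {P : (W.baseChange K).toAffine.Point}
    (hP : ¬ ∃ Q : (W.baseChange K).toAffine.Point, (p : ℤ) • Q = P) : ¬ IsOfFinAddOrder P := by
  intro hfin
  have hbot := torsionBy_eq_bot_of_isImaginaryQuadratic_of_hasIrreducibleModPGaloisRep W K hK hp hirr
  have hcop : p.Coprime (addOrderOf P) := by
    rw [Nat.Prime.coprime_iff_not_dvd hp]
    rintro ⟨k, hk⟩
    have hord : 0 < addOrderOf P := addOrderOf_pos_iff.mpr hfin
    have hk0 : 0 < k := Nat.pos_of_ne_zero fun h ↦ by rw [h, mul_zero] at hk; omega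
    have hmem : k • P ∈ AddSubgroup.torsionBy (W.baseChange K).toAffine.Point (p : ℤ) := by
      rw [mem_torsionBy_iff, natCast_zsmul, smul_smul, ← hk]
      exact addOrderOf_nsmul_eq_zero P
    rw [hbot, AddSubgroup.mem_bot] at hmem
    have hle : addOrderOf P ≤ k := Nat.le_of_dvd hk0 (addOrderOf_dvd_of_nsmul_eq_zero hmem)
    have hp1 : 2 ≤ p := hp.two_le
    nlinarith
  obtain ⟨m, hm⟩ := exists_nsmul_eq_self_of_coprime hcop
  exact hP ⟨m • P, by rw [natCast_zsmul, smul_comm, hm]⟩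

/-- **`#Sel_p(E/K) = p`, `E[p]` irreducible, and a point of `E(K)` outside `pE(K)` force `rank E(K) = 1` and
`Ш(E/K)[p] = 0`** (`K` imaginary quadratic): the point has infinite order (`not_isOfFinAddOrder_of_not_exists_zsmul_eq`),
so `rank E(K) ≥ 1` (`one_le_mordellWeilRank_of_infinite_point`), and the exact descent count
`#Sel^(p) = p^{rank} · #E(K)[p] · #Ш[p]` (`WeierstrassCurve.natCard_selmerGroup_eq`, with `#E(K)[p] = 1`) reads
`p = p^{rank} · #Ш[p]`, whence `rank = 1` and `#Ш[p] = 1`. Here `Ш(E/K)[p]` is `Ш ⊓ H¹(K, E)[p]`.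
[cite: SilvermanAEC2009, Thm X.4.2] [cite: BurungaleTian2019, Cor. 1.4 (proof)] -/
theorem mordellWeilRank_eq_one_and_sha_torsionBy_eq_bot (hK : IsImaginaryQuadratic K) {p : ℕ} [hp : Fact p.Prime]
    (hirr : W.HasIrreducibleModPGaloisRep p)
    (hSel : Nat.card (WeierstrassCurve.selmerGroup (W.baseChange K) (p : ℤ)) = p)
    {P : (W.baseChange K).toAffine.Point} (hP : ¬ ∃ Q : (W.baseChange K).toAffine.Point, (p : ℤ) • Q = P) :
    (W.baseChange K).mordellWeilRank = 1 ∧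
      ((W.baseChange K).sha ⊓ AddSubgroup.torsionBy (W.baseChange K).galH1 (p : ℤ) :
        AddSubgroup (W.baseChange K).galH1) = ⊥ := by
  have hpP : p.Prime := hp.out
  have hnt := not_isOfFinAddOrder_of_not_exists_zsmul_eq W hK hpP hirr hP
  -- rank ≥ 1
  have hinf : Infinite (W.baseChange K).toAffine.Point := by
    by_contra hfin
    rw [not_infinite_iff_finite] at hfin
    exact hnt (isOfFinAddOrder_of_finite P)
  have h1 : 1 ≤ (W.baseChange K).mordellWeilRank := one_le_mordellWeilRank_of_infinite_point (W.baseChange K) hinf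
  -- the exact descent count
  have hbot := torsionBy_eq_bot_of_isImaginaryQuadratic_of_hasIrreducibleModPGaloisRep W K hK hpP hirr
  have ht : Nat.card (AddSubgroup.torsionBy (W.baseChange K).toAffine.Point (p : ℤ)) = 1 := by
    rw [hbot]; exact AddSubgroup.card_bot
  have hcard := (W.baseChange K).natCard_selmerGroup_eq hpP.ne_zero
  rw [hSel, ht, mul_one] at hcard
  -- `p = p^r · s` with `r ≥ 1`, `s ≥ 1` ⟹ `r = 1`, `s = 1`
  set r := (W.baseChange K).mordellWeilRank with hr
  set s := Nat.card ((W.baseChange K).sha ⊓ AddSubgroup.torsionBy (W.baseChange K).galH1 (p : ℤ) :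
    AddSubgroup (W.baseChange K).galH1) with hs
  have hs1 : 1 ≤ s := Nat.one_le_iff_ne_zero.mpr fun h0 ↦ by
    rw [h0, mul_zero] at hcard
    exact hpP.ne_zero hcard
  have hpr : p ^ r ≤ p := by
    calc p ^ r = p ^ r * 1 := (mul_one _).symm
      _ ≤ p ^ r * s := Nat.mul_le_mul_left _ hs1
      _ = p := hcard.symm
  have hr1 : r ≤ 1 := by
    by_contra hr2
    have : p ^ 2 ≤ p ^ r := Nat.pow_le_pow_right hpP.pos (by omega)
    have hp2 : p < p ^ 2 := by nlinarith [hpP.two_le]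
    omega
  have hr_eq : r = 1 := le_antisymm hr1 h1
  refine ⟨hr_eq, ?_⟩
  rw [hr_eq, pow_one] at hcard
  have hs_eq : s = 1 := by
    have : p * s = p * 1 := by rw [mul_one]; exact hcard.symm
    exact Nat.eq_of_mul_eq_mul_left hpP.pos this
  exact AddSubgroup.eq_bot_of_card_eq _ hs_eq

end Rank

/-- **`BottomRankOneAdditive` forces «`y_K ∉ pE(K)`, `y_K` of infinite order, `rank E(K) = 1`, `Ш(E/K)[p] = 0`» on
every one of its frames** — the conclusions of Gross–Zagier (non-torsion) and of Kolyvagin's theorem mod `p` (rank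
one, `Ш[p] = 0`), which the route otherwise carries as the NAMED published inputs `gross_zagier` ∕ `kolyvagin` of
`PublishedInputsAdditiveKoly`, follow here from the crux ALONE: `c(1) ≠ 0` ⇒ `P(1) ∉ p·E(K[1])` (McCallum Cor. 4.5
«if») ⇒ `y_K ∉ pE(K)` (descent, `E(K[1])[p] = 0`) ⇒ §3. CONDITIONAL on the crux; nothing is booked. Census
consequence: see the module docstring. [cite: GrossLMS1991, §1 (1.1), Thm. 1.3, §4] [cite: SilvermanAEC2009, Thm X.4.2] -/
theorem bottomRankOneAdditive_forces_rank_one_and_sha_torsionBy_eq_bot (hBOT : BottomRankOneAdditive) :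
    ∀ (W : WeierstrassCurve ℚ) [W.IsElliptic] [W.IsGloballyMinimal] [NeZero (W.conductorNorm ℤ)]
      (p : ℕ) [Fact p.Prime] (K : Type) [Field K] [NumberField K]
      (Dt : ModularParametrizationData W (W.conductorNorm ℤ)) (β : ℤ) (ι : K →+* ℂ),
      5 ≤ p → Addv W p → W.HasSurjectiveModNGaloisRep p →
      (∀ (ℓ : ℕ) [Fact ℓ.Prime], W.HasMultiplicativeReductionAtPrime ℓ →
        ¬ p ∣ padicValInt ℓ W.minimalDiscriminantInt) →
      (∃ (ℓ₁ ℓ₂ : ℕ) (_ : Fact ℓ₁.Prime) (_ : Fact ℓ₂.Prime), ℓ₁ ≠ ℓ₂ ∧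
        W.HasMultiplicativeReductionAtPrime ℓ₁ ∧ W.HasMultiplicativeReductionAtPrime ℓ₂) →
      ¬ p ∣ W.tamagawaProduct → W.analyticRank = 1 →
      IsImaginaryQuadratic K → Odd (NumberField.discr K) → NumberField.discr K < -4 →
      SatisfiesHeegnerHypothesis (W.conductorNorm ℤ) K →
      (W.quadraticTwist (NumberField.discr K : ℚ)).entireLFunction 1 ≠ 0 →
      (4 * (W.conductorNorm ℤ : ℤ)) ∣ β ^ 2 - NumberField.discr K → ¬ (p : ℤ) ∣ Dt.c →
      Nat.card (WeierstrassCurve.selmerGroup (W.baseChange K) (p : ℤ)) = p →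
      ∃ (d : KolyvaginHeegnerData Dt β ι 1) (yK : (W.baseChange K).toAffine.Point),
        IsHeegnerPoint (W.conductorNorm ℤ) W K yK ∧
        WeierstrassCurve.Affine.Point.map (W' := W) (algebraMap K (ringClassField K ι 1)).toRatAlgHom yK =
          d.derivedPoint ∧
        (¬ ∃ Q : (W.baseChange K).toAffine.Point, (p : ℤ) • Q = yK) ∧ ¬ IsOfFinAddOrder yK ∧
        (W.baseChange K).mordellWeilRank = 1 ∧
        ((W.baseChange K).sha ⊓ AddSubgroup.torsionBy (W.baseChange K).galH1 (p : ℤ) :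
          AddSubgroup (W.baseChange K).galH1) = ⊥ := by
  intro W _ _ _ p hp K _ _ Dt β ι hp5 hadd hs hsp htwo htam hr hK hodd hlt hH hL hβ hc hSel
  obtain ⟨d, hne⟩ := hBOT W p K Dt β ι hp5 hadd hs hsp htwo htam hr hK hodd hlt hH hL hβ hc hSel
  obtain ⟨yK, hyK, hmap⟩ := exists_isHeegnerPoint_map_eq_derivedPoint_one W K Dt β ι hK hH d
  have hirr : W.HasIrreducibleModPGaloisRep p := hasIrreducibleModPGaloisRep_of_hasSurjectiveModNGaloisRep W p hs
  have hndiv : ¬ ∃ Q : (W.baseChange K).toAffine.Point, (p : ℤ) • Q = yK :=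
    (kolyvaginClass_one_ne_zero_iff_not_exists_zsmul_eq W p K Dt β ι hp5 hs hK hlt hH d yK hmap).mp hne
  obtain ⟨hrank, hsha⟩ := mordellWeilRank_eq_one_and_sha_torsionBy_eq_bot W hK hirr hSel hndiv
  exact ⟨d, yK, hyK, hmap, hndiv, not_isOfFinAddOrder_of_not_exists_zsmul_eq W hK hp.out hirr hndiv, hrank, hsha⟩

end Summit.BirchSwinnertonDyer.BirchSwinnertonDyer.Theorems.AdditiveKoly

end
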